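import Summits.KontsevichZagierPeriods.KontsevichZagierPeriods.Theses.SymplecticScissors
import Literature.NumberTheory.Transcendental.AyoubPeriodSeries
import Literature.NumberTheory.Transcendental.AyoubPeriodSeriesKernel

/-!
# `TypeAGeneration` (stmt-KontsevichZagierPeriods-18392), line `Sketch`, stub
`stub_rootElimination` (PF-a): root elimination for one-variable rational integrands

Registered stub `stub_rootElimination` of the crux `TypeAGeneration` (route SymplecticScissors,
line `Sketch` = card stokes-compiler), on top of
`Literature/NumberTheory/Transcendental/AyoubPeriodSeries.lean` (`AyoubRel.CSeries = ℂ[[z]]`,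
`AyoubRel.HasPolyradiusGtOne`: `Σ_a ‖c_a‖ r^{|a|} < ∞` for some `r > 1`).

**Statement.** Let `F ∈ ℂ[[z]]` have polyradius of convergence `> 1` and satisfy
`B(zᵢ)·F = A(zᵢ)` for one-variable polynomials `A, B ∈ ℂ[T]` with coefficients algebraic over `ℚ`,
`B ≠ 0`. Then also `B′(zᵢ)·F = A′(zᵢ)` for such `A′, B′` with `B′ ≠ 0` having **no complex root in
the closed unit disc**.

**Proof.** Induction on `deg B`. If `B(z₀) = 0` with `‖z₀‖ ≤ 1`, the identity `B·F = A` can be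
evaluated at `zᵢ = z₀` along the axis `zᵢ`: the coefficients `Fₙ = coeff_{zᵢⁿ} F` are absolutely
summable (`‖z₀‖ ≤ 1 < r`), `Aₙ = Σ_{k+l=n} Bₖ Fₗ` (`MvPowerSeries.coeff_mul` on the antidiagonal of
`single i n`), and the Cauchy product (`tsum_mul_tsum_eq_tsum_sum_antidiagonal_of_summable_norm`)
gives `A(z₀) = B(z₀)·F(z₀) = 0`. Hence `A = (T − z₀)A₁`, `B = (T − z₀)B₁`
(`Polynomial.mul_divByMonic_eq_iff_isRoot`), and `zᵢ − z₀ ≠ 0` cancels in the domain `ℂ[[z]]`: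
`B₁·F = A₁` with `deg B₁ < deg B`. The root `z₀` is algebraic (a root of a non-zero polynomial over
the subalgebra `ℚ̄ = {algebraic numbers} ⊆ ℂ`, `IsAlgebraic.restrictScalars`), so the quotients
`A₁, B₁` keep algebraic coefficients (`Polynomial.map_divByMonic` over `ℚ̄`).

Elementary (folklore); no definition is introduced.
-/

noncomputable section

-- `Summit.KontsevichZagierPeriods.KontsevichZagierPeriods.…` is the tree's mandated layout (single-conjunct summit).
set_option linter.dupNamespace false

namespace Summit.KontsevichZagierPeriods.KontsevichZagierPeriods.TypeAGenerationLine

open Finsupp MvPowerSeries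
open Literature.NumberTheory.Transcendental
open Literature.NumberTheory.Transcendental.AyoubRel

/-! ## Coefficients of `B(zᵢ)·F` along the axis `zᵢ` -/

/-- `coeff_{zᵢᵏ} B(zᵢ) = Bₖ` for a one-variable polynomial `B`. [folklore] -/
theorem pa_coeff_single_aeval (i : ℕ) (B : Polynomial ℂ) (k : ℕ) :
    coeff (single i k) (Polynomial.aeval (X i : CSeries) B) = B.coeff k := by
  classical
  rw [Polynomial.aeval_eq_sum_range, map_sum]
  simp_rw [map_smul, coeff_X_pow, (single_injective i).eq_iff, smul_eq_mul, mul_ite, mul_one,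
    mul_zero]
  rw [Finset.sum_ite_eq]
  split_ifs with h
  · rfl
  · rw [Finset.mem_range, not_lt] at h
    exact (Polynomial.coeff_eq_zero_of_natDegree_lt h).symm

/-- `coeff_{zᵢⁿ} (B(zᵢ)·F) = Σ_{k+l=n} Bₖ · coeff_{zᵢˡ} F`. [folklore] -/
theorem pa_coeff_single_aeval_mul (i : ℕ) (B : Polynomial ℂ) (F : CSeries) (n : ℕ) :
    coeff (single i n) (Polynomial.aeval (X i : CSeries) B * F) =
      ∑ kl ∈ Finset.HasAntidiagonal.antidiagonal n, B.coeff kl.1 * coeff (single i kl.2) F := by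
  classical
  rw [coeff_mul, antidiagonal_single, Finset.sum_map]
  simp [pa_coeff_single_aeval]

/-- `zᵢ − z₀ ≠ 0` in `ℂ[[z]]`. [folklore] -/
theorem pa_aeval_X_sub_C_ne_zero (i : ℕ) (z : ℂ) :
    Polynomial.aeval (X i : CSeries) (Polynomial.X - Polynomial.C z) ≠ 0 := by
  intro h
  have h1 := congrArg (coeff (single i 1)) h
  rw [pa_coeff_single_aeval, map_zero, Polynomial.coeff_sub, Polynomial.coeff_X_one,
    Polynomial.coeff_C, if_neg one_ne_zero, sub_zero] at h1
  exact one_ne_zero h1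

/-! ## Evaluating `B·F = A` at a point of the closed unit disc -/

/-- Along the axis `zᵢ` the coefficients of a series of polyradius `> 1` are absolutely summable
against `z₀ⁿ`, `‖z₀‖ ≤ 1`. [folklore] -/
theorem pa_summable_axis {F : CSeries} (hF : HasPolyradiusGtOne F) (i : ℕ) {z : ℂ}
    (hz : ‖z‖ ≤ 1) : Summable fun n : ℕ => ‖coeff (single i n) F * z ^ n‖ := by
  have hs := (summable_norm_coeff_of_hasPolyradiusGtOne hF).comp_injective (single_injective i)
  refine Summable.of_nonneg_of_le (fun n => norm_nonneg _) (fun n => ?_) hs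
  rw [Function.comp_apply, norm_mul, norm_pow]
  exact mul_le_of_le_one_right (norm_nonneg _) (pow_le_one₀ (norm_nonneg _) hz)

/-- **Evaluation**: if `B(zᵢ)·F = A(zᵢ)` in `ℂ[[z]]` and `‖z₀‖ ≤ 1`, then
`B(z₀) · Σₙ Fₙ z₀ⁿ = A(z₀)` (`Fₙ = coeff_{zᵢⁿ} F`; Cauchy product of an absolutely convergent
series with a finite one). [folklore] -/
theorem pa_eval_mul_tsum_eq (i : ℕ) {F : CSeries} (hF : HasPolyradiusGtOne F)
    {A B : Polynomial ℂ}
    (hId : Polynomial.aeval (X i : CSeries) B * F = Polynomial.aeval (X i : CSeries) A)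
    {z : ℂ} (hz : ‖z‖ ≤ 1) :
    B.eval z * ∑' n, coeff (single i n) F * z ^ n = A.eval z := by
  have hg := pa_summable_axis hF i hz
  have hfin : ∀ P : Polynomial ℂ, ∀ n ∉ P.support, P.coeff n * z ^ n = 0 := fun P n hn => by
    rw [Polynomial.notMem_support_iff.mp hn, zero_mul]
  have hsumP : ∀ P : Polynomial ℂ, ∑' n, P.coeff n * z ^ n = P.eval z := fun P => by
    rw [tsum_eq_sum (hfin P), Polynomial.eval_eq_sum, Polynomial.sum_def]
  have hb : Summable fun n => ‖B.coeff n * z ^ n‖ :=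
    summable_of_ne_finset_zero fun n hn => by rw [hfin B n hn, norm_zero]
  rw [← hsumP B, ← hsumP A, tsum_mul_tsum_eq_tsum_sum_antidiagonal_of_summable_norm hb hg]
  refine tsum_congr fun n => ?_
  rw [← pa_coeff_single_aeval i A n, ← hId, pa_coeff_single_aeval_mul, Finset.sum_mul]
  refine Finset.sum_congr rfl fun kl hkl => ?_
  rw [Finset.HasAntidiagonal.mem_antidiagonal] at hkl
  rw [← hkl, pow_add]
  ring

/-- A root of `B` in the closed unit disc is a root of `A`. [folklore] -/
theorem pa_isRoot_of_isRoot (i : ℕ) {F : CSeries} (hF : HasPolyradiusGtOne F)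
    {A B : Polynomial ℂ}
    (hId : Polynomial.aeval (X i : CSeries) B * F = Polynomial.aeval (X i : CSeries) A)
    {z : ℂ} (hz : ‖z‖ ≤ 1) (hBz : B.IsRoot z) : A.IsRoot z := by
  rw [Polynomial.IsRoot.def] at hBz ⊢
  rw [← pa_eval_mul_tsum_eq i hF hId hz, hBz, zero_mul]

/-! ## Algebraicity bookkeeping over `ℚ̄ ⊆ ℂ` -/

/-- A polynomial with algebraic coefficients comes from `ℚ̄[T]`, `ℚ̄ ⊆ ℂ` the subalgebra of
algebraic numbers. [folklore] -/
theorem pa_exists_map_eq {A : Polynomial ℂ} (hA : ∀ n, IsAlgebraic ℚ (A.coeff n)) :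
    ∃ A' : Polynomial (Subalgebra.algebraicClosure ℚ ℂ),
      A'.map (algebraMap (Subalgebra.algebraicClosure ℚ ℂ) ℂ) = A :=
  (Polynomial.mem_lifts A).mp
    ((Polynomial.lifts_iff_coeff_lifts A).mpr fun n => ⟨⟨A.coeff n, hA n⟩, rfl⟩)

/-- **A root of a non-zero polynomial with algebraic coefficients is algebraic** (transitivity
of algebraicity, `IsAlgebraic.restrictScalars`). [folklore] -/
theorem pa_isAlgebraic_of_isRoot {B : Polynomial ℂ} (hB : B ≠ 0)
    (hBalg : ∀ n, IsAlgebraic ℚ (B.coeff n)) {z : ℂ} (hz : B.IsRoot z) : IsAlgebraic ℚ z := by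
  obtain ⟨B', hB'⟩ := pa_exists_map_eq hBalg
  have hB'0 : B' ≠ 0 := by
    rintro rfl
    exact hB (by rw [← hB', Polynomial.map_zero])
  have halg : IsAlgebraic (Subalgebra.algebraicClosure ℚ ℂ) z :=
    ⟨B', hB'0, by rw [Polynomial.aeval_def, ← Polynomial.eval_map, hB']; exact hz⟩
  exact halg.restrictScalars ℚ

/-- Dividing by `T − z₀`, `z₀` algebraic, keeps the coefficients algebraic
(`Polynomial.map_divByMonic` over `ℚ̄`). [folklore] -/
theorem pa_isAlgebraic_coeff_divByMonic {A : Polynomial ℂ} (hA : ∀ n, IsAlgebraic ℚ (A.coeff n))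
    {z : ℂ} (hz : IsAlgebraic ℚ z) (n : ℕ) :
    IsAlgebraic ℚ ((A /ₘ (Polynomial.X - Polynomial.C z)).coeff n) := by
  obtain ⟨A', hA'⟩ := pa_exists_map_eq hA
  have hXC : (Polynomial.X - Polynomial.C z : Polynomial ℂ) =
      (Polynomial.X - Polynomial.C (⟨z, hz⟩ : Subalgebra.algebraicClosure ℚ ℂ)).map
        (algebraMap (Subalgebra.algebraicClosure ℚ ℂ) ℂ) := by
    rw [Polynomial.map_sub, Polynomial.map_X, Polynomial.map_C]
    rfl
  rw [← hA', hXC, ← Polynomial.map_divByMonic _ (Polynomial.monic_X_sub_C _), Polynomial.coeff_map]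
  exact ((A' /ₘ (Polynomial.X - Polynomial.C _)).coeff n).2

/-! ## The induction on `deg B` -/

/-- The inductive core of root elimination: the statement for all denominators `B` of
`natDegree d`, by strong induction on `d` (one root of the closed unit disc removed at a time).
[folklore] -/
theorem pa_rootElimination_aux (i : ℕ) {F : CSeries} (hF : HasPolyradiusGtOne F) (d : ℕ) :
    ∀ (A B : Polynomial ℂ), B.natDegree = d → B ≠ 0 → (∀ n, IsAlgebraic ℚ (A.coeff n)) →
      (∀ n, IsAlgebraic ℚ (B.coeff n)) →
      Polynomial.aeval (X i : CSeries) B * F = Polynomial.aeval (X i : CSeries) A →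
      ∃ A' B' : Polynomial ℂ, B' ≠ 0 ∧ (∀ n, IsAlgebraic ℚ (A'.coeff n)) ∧
        (∀ n, IsAlgebraic ℚ (B'.coeff n)) ∧ (∀ z : ℂ, B'.IsRoot z → 1 < ‖z‖) ∧
        Polynomial.aeval (X i : CSeries) B' * F = Polynomial.aeval (X i : CSeries) A' := by
  induction d using Nat.strong_induction_on with
  | _ d ih =>
  intro A B hdeg hB hA hBalg hId
  by_cases hroot : ∃ z : ℂ, B.IsRoot z ∧ ‖z‖ ≤ 1
  swap
  · push Not at hroot
    exact ⟨A, B, hB, hA, hBalg, hroot, hId⟩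
  obtain ⟨z, hBz, hz⟩ := hroot
  have hAz : A.IsRoot z := pa_isRoot_of_isRoot i hF hId hz hBz
  have hzalg : IsAlgebraic ℚ z := pa_isAlgebraic_of_isRoot hB hBalg hBz
  have hBfac : (Polynomial.X - Polynomial.C z) * (B /ₘ (Polynomial.X - Polynomial.C z)) = B :=
    Polynomial.mul_divByMonic_eq_iff_isRoot.mpr hBz
  have hAfac : (Polynomial.X - Polynomial.C z) * (A /ₘ (Polynomial.X - Polynomial.C z)) = A :=
    Polynomial.mul_divByMonic_eq_iff_isRoot.mpr hAz
  have hB₁ : B /ₘ (Polynomial.X - Polynomial.C z) ≠ 0 := fun h =>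
    hB (by rw [← hBfac, h, mul_zero])
  have hdeg₁ : (B /ₘ (Polynomial.X - Polynomial.C z)).natDegree < d := by
    have h1 := congrArg Polynomial.natDegree hBfac
    rw [Polynomial.natDegree_mul (Polynomial.X_sub_C_ne_zero z) hB₁, Polynomial.natDegree_X_sub_C,
      hdeg] at h1
    omega
  have hId₁ : Polynomial.aeval (X i : CSeries) (B /ₘ (Polynomial.X - Polynomial.C z)) * F =
      Polynomial.aeval (X i : CSeries) (A /ₘ (Polynomial.X - Polynomial.C z)) := by
    refine mul_left_cancel₀ (pa_aeval_X_sub_C_ne_zero i z) ?_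
    rw [← mul_assoc, ← map_mul, hBfac, hId, ← map_mul, hAfac]
  exact ih _ hdeg₁ _ _ rfl hB₁ (pa_isAlgebraic_coeff_divByMonic hA hzalg)
    (pa_isAlgebraic_coeff_divByMonic hBalg hzalg) hId₁

/-- **PF-a — ROOT ELIMINATION.** A one-variable `F` of polyradius `> 1` with `B·F = A`
(`A, B ∈ ℚ̄[zᵢ]`, `B ≠ 0`) also satisfies `B′·F = A′` with `B′ ≠ 0` having NO root in the closed
unit disc: if `B(z₀) = 0` with `‖z₀‖ ≤ 1`, evaluating the absolutely convergent identity at `z₀`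
gives `A(z₀) = 0`, and the common factor `zᵢ − z₀` cancels in the domain `ℂ[[z]]` (induction on
`deg B`; roots of `B` are algebraic). [folklore] -/
theorem stub_rootElimination :
    ∀ (i : ℕ) (F : CSeries), HasPolyradiusGtOne F → (∀ l : ℕ, UsesVar F l → l = i) →
      ∀ (A B : Polynomial ℂ), B ≠ 0 → (∀ n, IsAlgebraic ℚ (A.coeff n)) →
        (∀ n, IsAlgebraic ℚ (B.coeff n)) →
        Polynomial.aeval (X i : CSeries) B * F = Polynomial.aeval (X i : CSeries) A →
        ∃ A' B' : Polynomial ℂ, B' ≠ 0 ∧ (∀ n, IsAlgebraic ℚ (A'.coeff n)) ∧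
          (∀ n, IsAlgebraic ℚ (B'.coeff n)) ∧ (∀ z : ℂ, B'.IsRoot z → 1 < ‖z‖) ∧
          Polynomial.aeval (X i : CSeries) B' * F = Polynomial.aeval (X i : CSeries) A' :=
  fun i _ hF _ A B hB hA hBalg hId =>
    pa_rootElimination_aux i hF B.natDegree A B rfl hB hA hBalg hId

end Summit.KontsevichZagierPeriods.KontsevichZagierPeriods.TypeAGenerationLine
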